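import Summits.BirchSwinnertonDyer.BirchSwinnertonDyer.Theorems.PrintCf2SplitBadTwoRestrictedSelmerBottomSnake
import HarnessLib

/-!
# Crux `PrintCf2.SplitBadTwoRankOneOfFacts` (stmt-BirchSwinnertonDyer-20368), road α, stub S3c — the bottom value of `𝔖_{v̄}(K, M)`:
# the KUMMER SQUARE form of the three-factor decomposition (Agboola 2007 Prop. 6.11: `|V| = #ker(E(K) ⊗ D_{𝔭*} → E(K_{𝔭*}) ⊗ D_{𝔭*})`)

Cell `bsd-print-cf2`, width seat `bsd-line-cf2-p1-w7` g2, file 2 (sequel of p661732 `…RestrictedSelmerBottomSnake`);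
`--supports stmt-BirchSwinnertonDyer-20368` (helper, Theses-free). HONEST FRAMING: nothing here closes a crux or a stub; BSD is not
proved by any of this; no summit statement is proved by this seat. No definition, no named fact, no `sorry`, no kit. beyond-print
theorem: no (bookkeeping).

WHAT THIS ADDS to p661732 (`natCard_restrictedSelmerBase_eq_three_mul`: `#𝔖_{v̄}(K, M) = #(Q ⊓ ker loc_{v̄}) · #Ш(K)[M] · #loc_v(𝔖_{v̄})`
for subgroups `Q ≤ 𝔖_v(K, M)`, `Q′ ≤ H¹(K_{v̄}, M)` with `loc_{v̄}(Q) = Q′`). In the source the two subgroups are IMAGES OF KUMMER MAPS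
and the first factor is the kernel of a LOCALISATION OF POINTS: Agboola (6.11) has the commutative square
`E(K) ⊗ D_{𝔭*} → Sel_rel(K, W*)` over `E(K_{𝔭*}) ⊗ D_{𝔭*} → H¹(K_{𝔭*}, W*)` (both Kummer maps injective) and
`V = ker(E(K) ⊗ D_{𝔭*} → E(K_{𝔭*}) ⊗ D_{𝔭*})`, `|V| = |U| = [E(K_{𝔭*}) ⊗ 𝒪 : loc(E(K) ⊗ 𝒪)]`. §1 proves, for an abstract
KUMMER SQUARE (`k : T → A`, `k′ : T′ → B`, `lam : T → T′`, `loc ∘ k = k′ ∘ lam`, `k′` injective): `k(T) ⊓ ker loc = k(ker lam)`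
(`range_inf_ker_eq_map_ker_of_sq`), so for `k` injective `#(k(T) ⊓ ker loc) = #ker lam` (`natCard_range_inf_ker_eq_natCard_ker_of_sq`),
and `loc(k(T)) = k′(T′)` when `lam` is onto (`map_range_eq_range_of_sq`); plus the `r = 1` mechanism by which ONTO is obtained in
the source — «`E(K_{𝔭*}) ⊗ D_{𝔭*}` is divisible of corank one», i.e. the local Kummer image is COCYCLIC (every proper subgroup
finite), so any infinite subgroup of it, such as the image of a point of infinite order, is all of it
(`le_of_forall_lt_finite_of_infinite`). §2 restates the three-factor decomposition of p661732 in this currency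
(`natCard_restrictedSelmerBase_eq_natCard_ker_mul`, `padicValNat_card_restrictedSelmerBase_eq_ker_add`): for every Kummer square over
the pair with `k(T) ≤ 𝔖_v(K, M)` and `lam` onto,
`#𝔖_{v̄}(K, M) = #ker lam · #((𝔖_v(K, M) ⊓ loc_{v̄}⁻¹ k′(T′)) ⧸ k(T)) · #loc_v(𝔖_{v̄}(K, M))` — LOCALISATION KERNEL OF POINTS × Ш(K)[M] ×
Poitou–Tate term; and the cocyclic variant (`…_of_cocyclic`) where ONTO is replaced by «`k′(T′)` cocyclic and `lam(T)` infinite».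

Road α reading (S3c of v10.3 / S3c₂ of v10.2, M = W* = ↥((W.baseChange K).endEigenPrimaryTorsion 2 π r)`, `p = 2`): `T = (W(K) ⊗ ℚ₂/ℤ₂)_{W*}`,
`T′ = (W(K_{v̄}) ⊗ ℚ₂/ℤ₂)_{W*} ≅ ℚ₂/ℤ₂` (cocyclic), `lam` = localisation, `#ker lam = 2^{ℓ + e₁([d]₂)}` by Prop. 8.1 at the additive
prime (brick B7 + the `ℚ`-generator `P`, `‖log(c₀P)/c₀‖ = 2^{−ℓ}`); the instantiation of `k` as the `W*`-projection of the tree's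
`WeierstrassCurve.kummerMapPInfty` (SelmerCorankProofs) is the next file of this lane. presearch: Agboola 2007 §6 (held,
arXiv:math/0602192 p0014–p0015) is the source of the square and of `|V| = |U|`; nothing new is claimed.

References: A. Agboola, Compositio Math. 143 (2007) = arXiv:math/0602192, §6 Prop. 6.11, §8 Prop. 8.1 [Agboola2007];
R. Greenberg, LNM 1716 (1999), §4 proof of Thm. 4.1 [GreenbergLNM1716].
-/

noncomputable section

open scoped Classical

set_option linter.dupNamespace false
set_option autoImplicit false

open NumberField IsDedekindDomain Field
open Literature.NumberTheory.EllipticCurves Literature.NumberTheory.EllipticCurves.GreenbergSelmer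
open Literature.NumberTheory.EllipticCurves.Castella2018.AcSelmer
open Literature.NumberTheory.EllipticCurves.Agboola2007
open Literature.NumberTheory.GaloisRepresentations

universe u

namespace Summit.BirchSwinnertonDyer.BirchSwinnertonDyer.Theorems.PrintCf2.RestrictedSelmerPair

/-! ## §1. Kummer squares: `k(T) ⊓ ker loc = k(ker lam)`, `loc(k(T)) = k′(T′)`, cocyclic targets -/

section KummerSquare

variable {A B T T' : Type*} [AddCommGroup A] [AddCommGroup B] [AddCommGroup T] [AddCommGroup T']
  (loc : A →+ B) (k : T →+ A) (k' : T' →+ B) (lam : T →+ T')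

/-- **In a Kummer square with injective local Kummer map, the global Kummer classes killed by `loc` are exactly the Kummer classes
of the localisation kernel**: `loc ∘ k = k′ ∘ lam`, `k′` injective ⟹ `k(T) ⊓ ker loc = k(ker lam)` (Agboola (6.11): the subgroup
`V ⊆ E(K) ⊗ D_{𝔭*}` of the snake). [cite: Agboola2007, Prop. 6.11 (arXiv p0014:L60–80)] -/
theorem range_inf_ker_eq_map_ker_of_sq (hsq : loc.comp k = k'.comp lam) (hk' : Function.Injective k') :
    k.range ⊓ loc.ker = lam.ker.map k := by
  ext a
  constructor
  · intro ha
    obtain ⟨ha1, ha2⟩ := AddSubgroup.mem_inf.1 ha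
    obtain ⟨t, rfl⟩ := AddMonoidHom.mem_range.1 ha1
    refine AddSubgroup.mem_map.2 ⟨t, ?_, rfl⟩
    rw [AddMonoidHom.mem_ker]
    apply hk'
    rw [map_zero, ← AddMonoidHom.comp_apply, ← hsq, AddMonoidHom.comp_apply]
    exact AddMonoidHom.mem_ker.mp ha2
  · intro ha
    obtain ⟨t, ht, rfl⟩ := AddSubgroup.mem_map.1 ha
    refine AddSubgroup.mem_inf.2 ⟨AddMonoidHom.mem_range.2 ⟨t, rfl⟩, ?_⟩
    rw [AddMonoidHom.mem_ker, ← AddMonoidHom.comp_apply, hsq, AddMonoidHom.comp_apply, AddMonoidHom.mem_ker.mp ht,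
      map_zero]

/-- **`#(k(T) ⊓ ker loc) = #ker lam`** for a Kummer square with BOTH Kummer maps injective — Agboola's `|V|`, the first factor of
the bottom value, IS the order of the kernel of the localisation of points `T → T′`
(`E(K) ⊗ D_{𝔭*} → E(K_{𝔭*}) ⊗ D_{𝔭*}`; `|V| = |U| = [E(K_{𝔭*}) ⊗ 𝒪_{𝔭*} : loc(E(K) ⊗ 𝒪_{𝔭*})]`).
[cite: Agboola2007, Prop. 6.11 (arXiv p0014:L60–80)] -/
theorem natCard_range_inf_ker_eq_natCard_ker_of_sq (hsq : loc.comp k = k'.comp lam) (hk : Function.Injective k)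
    (hk' : Function.Injective k') :
    Nat.card ↥(k.range ⊓ loc.ker) = Nat.card lam.ker := by
  rw [range_inf_ker_eq_map_ker_of_sq loc k k' lam hsq hk']
  exact Nat.card_congr (AddSubgroup.equivMapOfInjective lam.ker k hk).toEquiv.symm

/-- **The localisation of the global Kummer image lies in the local Kummer image**: `loc(k(T)) ≤ k′(T′)` for any Kummer square.
[cite: Agboola2007, Prop. 6.11 (arXiv p0014:L81–90, the commutative diagram)] -/
theorem map_range_le_range_of_sq (hsq : loc.comp k = k'.comp lam) : k.range.map loc ≤ k'.range := by
  rintro _ ⟨a, ha, rfl⟩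
  obtain ⟨t, rfl⟩ := AddMonoidHom.mem_range.1 ha
  rw [← AddMonoidHom.comp_apply, hsq, AddMonoidHom.comp_apply]
  exact AddMonoidHom.mem_range.2 ⟨lam t, rfl⟩

/-- **`loc(k(T)) = k′(T′)` when the localisation of points is onto** (Agboola (6.11), `r ≥ 1`: the cokernel of
`E(K) ⊗ D_{𝔭*} → E(K_{𝔭*}) ⊗ D_{𝔭*}` vanishes). [cite: Agboola2007, Prop. 6.11 (arXiv p0014:L60–80)] -/
theorem map_range_eq_range_of_sq (hsq : loc.comp k = k'.comp lam) (hlam : Function.Surjective lam) :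
    k.range.map loc = k'.range := by
  apply le_antisymm (map_range_le_range_of_sq loc k k' lam hsq)
  rintro _ ⟨t', rfl⟩
  obtain ⟨t, rfl⟩ := hlam t'
  refine AddSubgroup.mem_map.2 ⟨k t, AddMonoidHom.mem_range.2 ⟨t, rfl⟩, ?_⟩
  rw [← AddMonoidHom.comp_apply, hsq, AddMonoidHom.comp_apply]

/-- **The `r = 1` mechanism: an infinite subgroup of a COCYCLIC group is everything.** If every proper subgroup of `Q′` is finite
(«`E(K_{𝔭*}) ⊗ D_{𝔭*}` is divisible of `𝒪_{K,𝔭*}`-corank one», i.e. `≅ K_{𝔭*}/𝒪_{𝔭*}`) and `H ≤ Q′` is infinite (the image of a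
point of infinite order tensored with `ℚ_p/ℤ_p`), then `H = Q′`. [cite: Agboola2007, Prop. 6.11 and Lemma 6.3(b) (arXiv p0014:L1–20)] -/
theorem le_of_forall_lt_finite_of_infinite {Q' H : AddSubgroup B} (hcocyc : ∀ H' : AddSubgroup B, H' < Q' → Finite H')
    (hle : H ≤ Q') (hinf : ¬ Finite H) : Q' ≤ H := by
  rcases hle.lt_or_eq with hlt | heq
  · exact absurd (hcocyc H hlt) hinf
  · exact heq.ge

end KummerSquare

/-! ## §2. The bottom value of `𝔖_{v̄}(K, M)` through a Kummer square over the pair -/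

section Base

variable {K : Type u} [Field K] [NumberField K] (M : Type u) [AddCommGroup M]
  [DistribMulAction (absoluteGaloisGroup K) M] [TopologicalSpace M] [DiscreteTopology M]
  (p : ℕ) (v vbar : HeightOneSpectrum (𝓞 K))
  {T T' : Type*} [AddCommGroup T] [AddCommGroup T']
  (k : T →+ subgroupH1 (⊤ : Subgroup (absoluteGaloisGroup K)) M)
  (k' : T' →+ subgroupH1 ((⊤ : Subgroup (absoluteGaloisGroup K)) ⊓ decomp vbar) M) (lam : T →+ T')

/-- **THE BOTTOM VALUE THROUGH A KUMMER SQUARE.** For every discrete `Γ_K`-module `M`, places `v`, `v̄`, and every Kummer square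
over the pair — `k : T → H¹(K, M)` («global points ⊗ `ℚ_p/ℤ_p` of the summand»), `k′ : T′ → H¹(K_{v̄}, M)` («local points at `v̄`»),
`lam : T → T′` (localisation), `loc_{v̄} ∘ k = k′ ∘ lam`, both Kummer maps injective, `k(T) ≤ 𝔖_v(K, M)` (global Kummer classes of the
summand are trivial away from `p`, strict at `v`) and `lam` ONTO (`r = 1`) —
`#𝔖_{v̄}(K, M) = #ker lam · #((𝔖_v(K, M) ⊓ loc_{v̄}⁻¹ k′(T′)) ⧸ k(T)) · #loc_v(𝔖_{v̄}(K, M))`: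
Agboola's `|𝔖_{𝔭*}(K, W*)| = |V| · |Ш(K)(𝔭*)| · [Ш_{rel(𝔭)} : Ш]` with `V = ker(E(K) ⊗ D_{𝔭*} → E(K_{𝔭*}) ⊗ D_{𝔭*})`.
[cite: Agboola2007, Props. 6.10, 6.11 (arXiv p0014:L1–p0015:L12)] -/
theorem natCard_restrictedSelmerBase_eq_natCard_ker_mul
    (hsq : (resOfLe M (inf_le_left : ⊤ ⊓ decomp vbar ≤ ⊤)).comp k = k'.comp lam)
    (hk : Function.Injective k) (hk' : Function.Injective k') (hkT : k.range ≤ restrictedSelmerBase M p v)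
    (hlam : Function.Surjective lam) :
    Nat.card (restrictedSelmerBase M p vbar) =
      Nat.card lam.ker *
        Nat.card (↥(restrictedSelmerBase M p v ⊓ k'.range.comap (resOfLe M (inf_le_left : ⊤ ⊓ decomp vbar ≤ ⊤))) ⧸
          k.range.addSubgroupOf
            (restrictedSelmerBase M p v ⊓ k'.range.comap (resOfLe M (inf_le_left : ⊤ ⊓ decomp vbar ≤ ⊤)))) *
        Nat.card ((resOfLe M (inf_le_left : ⊤ ⊓ decomp v ≤ ⊤)).comp (restrictedSelmerBase M p vbar).subtype).range := by
  rw [natCard_restrictedSelmerBase_eq_three_mul M p v vbar k.range k'.range hkT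
      (map_range_le_range_of_sq _ k k' lam hsq) (map_range_eq_range_of_sq _ k k' lam hsq hlam).ge,
    natCard_range_inf_ker_eq_natCard_ker_of_sq _ k k' lam hsq hk hk']

/-- **`ord_p` FORM through a Kummer square** (finite `𝔖_{v̄}(K, M)`):
`ord_p #𝔖_{v̄}(K, M) = ord_p #ker lam + ord_p #Ш(K)[M] + ord_p #loc_v(𝔖_{v̄}(K, M))` — on road α the first term is `ℓ + e₁([d]₂)`
(Prop. 8.1 at the additive prime: brick B7 + the `ℚ`-generator), the second the Ш-term (B6 chain), the third the Poitou–Tate term.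
[cite: Agboola2007, Thm. B via Props. 6.10, 6.11, 8.1 (arXiv p0017:L60–75)] -/
theorem padicValNat_card_restrictedSelmerBase_eq_ker_add [Fact p.Prime] [Finite (restrictedSelmerBase M p vbar)]
    (hsq : (resOfLe M (inf_le_left : ⊤ ⊓ decomp vbar ≤ ⊤)).comp k = k'.comp lam)
    (hk : Function.Injective k) (hk' : Function.Injective k') (hkT : k.range ≤ restrictedSelmerBase M p v)
    (hlam : Function.Surjective lam) :
    padicValNat p (Nat.card (restrictedSelmerBase M p vbar)) =
      padicValNat p (Nat.card lam.ker) +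
        padicValNat p (Nat.card
          (↥(restrictedSelmerBase M p v ⊓ k'.range.comap (resOfLe M (inf_le_left : ⊤ ⊓ decomp vbar ≤ ⊤))) ⧸
            k.range.addSubgroupOf
              (restrictedSelmerBase M p v ⊓ k'.range.comap (resOfLe M (inf_le_left : ⊤ ⊓ decomp vbar ≤ ⊤))))) +
        padicValNat p (Nat.card
          ((resOfLe M (inf_le_left : ⊤ ⊓ decomp v ≤ ⊤)).comp (restrictedSelmerBase M p vbar).subtype).range) := by
  rw [← natCard_range_inf_ker_eq_natCard_ker_of_sq _ k k' lam hsq hk hk']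
  exact padicValNat_card_restrictedSelmerBase_eq_add_three M p v vbar k.range k'.range hkT
    (map_range_le_range_of_sq _ k k' lam hsq) (map_range_eq_range_of_sq _ k k' lam hsq hlam).ge

/-- **Finiteness of the localisation kernel** `ker lam` (Agboola's `V`) when `𝔖_{v̄}(K, M)` is finite, for a Kummer square with
injective Kummer maps, `k(T) ≤ 𝔖_v(K, M)` and `lam` onto. [cite: Agboola2007, Prop. 6.11 (arXiv p0014:L60–80)] -/
theorem finite_ker_of_finite_restrictedSelmerBase [Finite (restrictedSelmerBase M p vbar)]
    (hsq : (resOfLe M (inf_le_left : ⊤ ⊓ decomp vbar ≤ ⊤)).comp k = k'.comp lam)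
    (hk : Function.Injective k) (hk' : Function.Injective k') (hkT : k.range ≤ restrictedSelmerBase M p v)
    (hlam : Function.Surjective lam) : Finite lam.ker := by
  have h := (finite_three_of_finite_restrictedSelmerBase M p v vbar k.range k'.range hkT
    (map_range_le_range_of_sq _ k k' lam hsq) (map_range_eq_range_of_sq _ k k' lam hsq hlam).ge).1
  rw [range_inf_ker_eq_map_ker_of_sq _ k k' lam hsq hk'] at h
  exact Finite.of_equiv _ (AddSubgroup.equivMapOfInjective lam.ker k hk).toEquiv.symm

/-- **COCYCLIC VARIANT** (how ONTO is obtained in the source, `r = 1`): the same three-factor identity when, instead of `lam` onto,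
the local Kummer image `k′(T′)` is COCYCLIC (every proper subgroup finite — «`E(K_{𝔭*}) ⊗ D_{𝔭*} ≅ K_{𝔭*}/𝒪_{𝔭*}`») and the
localised global Kummer image `loc_{v̄}(k(T))` is INFINITE (a point of infinite order); the first factor is then `#(k(T) ⊓ ker loc_{v̄})`
(`= #ker lam` by `natCard_range_inf_ker_eq_natCard_ker_of_sq`). [cite: Agboola2007, Prop. 6.11, Lemma 6.3(b) (arXiv p0014)] -/
theorem natCard_restrictedSelmerBase_eq_three_mul_of_cocyclic
    (hsq : (resOfLe M (inf_le_left : ⊤ ⊓ decomp vbar ≤ ⊤)).comp k = k'.comp lam)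
    (hkT : k.range ≤ restrictedSelmerBase M p v)
    (hcocyc : ∀ H' : AddSubgroup (subgroupH1 ((⊤ : Subgroup (absoluteGaloisGroup K)) ⊓ decomp vbar) M),
      H' < k'.range → Finite H')
    (hinf : ¬ Finite ↥(k.range.map (resOfLe M (inf_le_left : ⊤ ⊓ decomp vbar ≤ ⊤)))) :
    Nat.card (restrictedSelmerBase M p vbar) =
      Nat.card ↥(k.range ⊓ (resOfLe M (inf_le_left : ⊤ ⊓ decomp vbar ≤ ⊤)).ker) *
        Nat.card (↥(restrictedSelmerBase M p v ⊓ k'.range.comap (resOfLe M (inf_le_left : ⊤ ⊓ decomp vbar ≤ ⊤))) ⧸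
          k.range.addSubgroupOf
            (restrictedSelmerBase M p v ⊓ k'.range.comap (resOfLe M (inf_le_left : ⊤ ⊓ decomp vbar ≤ ⊤)))) *
        Nat.card ((resOfLe M (inf_le_left : ⊤ ⊓ decomp v ≤ ⊤)).comp (restrictedSelmerBase M p vbar).subtype).range :=
  natCard_restrictedSelmerBase_eq_three_mul M p v vbar k.range k'.range hkT (map_range_le_range_of_sq _ k k' lam hsq)
    (le_of_forall_lt_finite_of_infinite hcocyc (map_range_le_range_of_sq _ k k' lam hsq) hinf)

end Base

end Summit.BirchSwinnertonDyer.BirchSwinnertonDyer.Theorems.PrintCf2.RestrictedSelmerPair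

end
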